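import Literature.NumberTheory.Rogawski1990.ArchCentralLimitFormulaOfWallValues   -- ★ p844011 (this seat): FILE B `ArchCentralLimitFormulaRankTwo.of_cornerRegularity_of_wallValues`
import Mathlib.Analysis.Calculus.IteratedDeriv.Lemmas
import HarnessLib

/-!
# N1 ASSEMBLY, FILE A′ — THE INVERSION SYMMETRY `z ↦ z̄` OF THE CORNER VALUE: the D-chamber wall value on the `θ₂`-MINIMAL pair (`σ 0 = 2`, wall parameters `t > 0`) already gives it on the
# `θ₂`-MAXIMAL pair (`σ 2 = 2`, `t < 0`) (Rogawski 1990 §8.4 pp. 126–127; Harish-Chandra [H₂] L. 17.5 — the symmetry `γ ↦ γ⁻¹` of the compact Cartan)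

Topic `NumberTheory/Rogawski1990`; namespace `Literature.NumberTheory.Rogawski1990`.  THEOREMS ONLY (no `def`, no instance, no notation, no axiom, no named fact, no `sorry`).
Cell `pub/hodgecm-mathlib`, ENGINE T1 (crux H413 = `stmt-HodgeConjecture-24833`); ROAD A toward N1 = `stub_L21` ∕ `stub_ArchCentralLimitU21`; ROAD A owner F0P3a-p05 (g14) WORD R-14.3 (d) and
«=» 11:31:11Z («if W6 exports one sign only, p02's FILE A′ inversion transport is = in advance»).  WHY: the (A3) wall germs ★ `exists_wallGerm_psi` (p843581) live on `t ∈ (0, 2π∕3)` — the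
wall points `ζ·(e^{it}, e^{it}, e^{−2it})` with `θ₂` MINIMAL, i.e. the closure of the chambers `[2,0,1]`, `[2,1,0]` (`σ 0 = 2`); the `θ₂`-MAXIMAL pair `[0,1,2]`, `[1,0,2]` (`σ 2 = 2`, ★ (A4)-I `_neg`)
would need a second pass of the chart engine.  This file removes that need.

THE SYMMETRY.  Let `Θ^∨(A) := Θ(J⁻¹ Aᴴ J)`, `J = σ_w(diag α)` — an ambient smooth function that IS `k ↦ Θ(k⁻¹)` on `G_w = U(J)(ℂ)` (`kᴴJk = J`), with compact support on `G_w`; its torus orbital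
integral is `Φ_{Θ^∨}(z) = Φ_Θ(z⁻¹)` (`(g·t(z)·g⁻¹)⁻¹ = g·t(z⁻¹)·g⁻¹`, SAME Haar measure — no inversion invariance needed), and `ρ′Δ(z⁻¹) = −ρ′Δ(z)`, so
`F_{Θ^∨}(ζ⁻¹e^{iθ}) = −F_Θ(ζe^{−iθ})`.  Hence if `H` is a `C³` corner extension of `F_Θ∘chart_ζ` on `C_σ` with `σ 2 = 2`, then `H^∨(θ) := −H(−θ)` is one of `F_{Θ^∨}∘chart_{ζ⁻¹}` on
`−C_σ = C_{σ·(0 2)}` (a `σ 0 = 2` chamber), `Λ₈^∠[H^∨](0) = Λ₈^∠[H](0)` (three sign flips), and `Θ^∨(ζ⁻¹•1) = Θ(ζ•1)`.  RESULT: **`cornerValue_max_of_min`** — the `hval`-shaped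
D-chamber value on `σ 0 = 2` (ONE `c` per `ν`, all `Θ`, all `ζ`) implies the same on `σ 0 = 2 ∨ σ 2 = 2` — and the corollary **`ArchCentralLimitFormulaRankTwo.of_cornerRegularity_of_wallValues_min`**
= ★ FILE B with `hD` only on the `θ₂`-minimal pair.  So W6 may stop at `t > 0`.
HONEST LABEL: HC_CM is proved only modulo the printed citations until rung 0 closes; bookkeeping around the printed-hard letter N1, pays nothing by itself.

## References
* [Rogawski1990] J. D. Rogawski, *Automorphic Representations of Unitary Groups in Three Variables*, Ann. of Math. Stud. 123 (1990), §8.4 pp. 126–127.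
* [HarishChandra1975HARRG1] Harish-Chandra, *Harmonic analysis on real reductive groups I*, J. Funct. Anal. 19 (1975), §17 Lemma 17.5.
* [PlatonovRapinchuk1994] V. Platonov, A. Rapinchuk, *Algebraic Groups and Number Theory* (1994), §2.3 (unitary groups of hermitian forms: `g⁻¹ = J⁻¹gᴴJ`).
-/

set_option autoImplicit false

noncomputable section

open Filter Topology Set MeasureTheory Measure NumberField NumberField.InfinitePlace Matrix
open Literature.NumberTheory.Automorphic Literature.NumberTheory.Automorphic.UnitaryGroup Literature.Analysis.Calculus
open scoped Matrix MatrixGroups Matrix.Norms.Operator ComplexConjugate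

namespace Literature.NumberTheory.Rogawski1990

/-! ## §1 The ambient inversion `A ↦ J⁻¹AᴴJ` of `U(σ_w diag α)(ℂ)` -/

section Ambient

variable (L : Type) [Field L] (α : Fin 3 → L) (w : {w : InfinitePlace L // IsComplex w})

/-- `A ↦ Aᴴ` is (real-)smooth on `M₃(ℂ)` (entrywise `conj`). [folklore] [cite: PlatonovRapinchuk1994, §2.3] -/
theorem contDiff_conjTranspose_fin_three : ContDiff ℝ (⊤ : ℕ∞) fun A : Matrix (Fin 3) (Fin 3) ℂ => Aᴴ := by
  have h : ContDiff ℝ (⊤ : ℕ∞) fun A : Fin 3 → Fin 3 → ℂ => fun i j => (starRingEnd ℂ) (A j i) := by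
    refine contDiff_pi.2 fun i => contDiff_pi.2 fun j => ?_
    have hij : ContDiff ℝ (⊤ : ℕ∞) fun A : Fin 3 → Fin 3 → ℂ => A j i :=
      (contDiff_apply ℝ ℂ i).comp (contDiff_apply ℝ (Fin 3 → ℂ) j)
    exact Complex.conjCLE.contDiff.comp hij
  -- transport through the identity `(Fin 3 → Fin 3 → ℂ) ≃L[ℝ] Matrix (Fin 3) (Fin 3) ℂ` (the matrix norm in scope is the `L^∞`-operator norm)
  let e : (Fin 3 → Fin 3 → ℂ) ≃L[ℝ] Matrix (Fin 3) (Fin 3) ℂ := (LinearEquiv.refl ℝ (Fin 3 → Fin 3 → ℂ)).toContinuousLinearEquiv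
  have h3 : ContDiff ℝ (⊤ : ℕ∞) fun A : Matrix (Fin 3) (Fin 3) ℂ => e (fun i j => (starRingEnd ℂ) ((e.symm A) j i)) :=
    e.contDiff.comp (h.comp e.symm.contDiff)
  have heq : (fun A : Matrix (Fin 3) (Fin 3) ℂ => Aᴴ) = fun A => e (fun i j => (starRingEnd ℂ) ((e.symm A) j i)) := by
    funext A
    ext i j
    rfl
  rw [heq]
  exact h3

/-- On the group, `J⁻¹ kᴴ J = k⁻¹` (`kᴴ J k = J`, `J = diag(σ_w α)` invertible). [cite: PlatonovRapinchuk1994, §2.3] -/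
theorem diagonal_inv_mul_conjTranspose_mul_diagonal_eq_inv (hα : ∀ i, α i ≠ 0) (k : archLocal L 3 (Matrix.diagonal α) w) :
    Matrix.diagonal (fun i : Fin 3 => (w.1.embedding (α i))⁻¹) * ((k : GL (Fin 3) ℂ) : Matrix (Fin 3) (Fin 3) ℂ)ᴴ *
        Matrix.diagonal (fun i : Fin 3 => w.1.embedding (α i)) =
      (((k⁻¹ : archLocal L 3 (Matrix.diagonal α) w) : GL (Fin 3) ℂ) : Matrix (Fin 3) (Fin 3) ℂ) := by
  have hmem := (mem_archLocal_iff_conjTranspose L 3 (Matrix.diagonal α) w (k : GL (Fin 3) ℂ)).1 k.2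
  rw [Matrix.diagonal_map (map_zero _)] at hmem
  have hJ : Matrix.diagonal (fun i : Fin 3 => (w.1.embedding (α i))⁻¹) * Matrix.diagonal (fun i : Fin 3 => w.1.embedding (α i)) = 1 := by
    rw [Matrix.diagonal_mul_diagonal, ← Matrix.diagonal_one]
    congr 1
    funext i
    exact inv_mul_cancel₀ ((map_ne_zero w.1.embedding).2 (hα i))
  have hleft : (Matrix.diagonal (fun i : Fin 3 => (w.1.embedding (α i))⁻¹) * ((k : GL (Fin 3) ℂ) : Matrix (Fin 3) (Fin 3) ℂ)ᴴ *
      Matrix.diagonal (fun i : Fin 3 => w.1.embedding (α i))) * ((k : GL (Fin 3) ℂ) : Matrix (Fin 3) (Fin 3) ℂ) = 1 := by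
    rw [Matrix.mul_assoc, Matrix.mul_assoc, ← Matrix.mul_assoc (((k : GL (Fin 3) ℂ) : Matrix (Fin 3) (Fin 3) ℂ)ᴴ)]
    have e : ((k : GL (Fin 3) ℂ) : Matrix (Fin 3) (Fin 3) ℂ)ᴴ * Matrix.diagonal (fun i : Fin 3 => w.1.embedding (α i)) * ((k : GL (Fin 3) ℂ) : Matrix (Fin 3) (Fin 3) ℂ) =
        Matrix.diagonal (fun i : Fin 3 => w.1.embedding (α i)) := by
      simpa only [Function.comp_def] using hmem
    rw [Matrix.mul_assoc (((k : GL (Fin 3) ℂ) : Matrix (Fin 3) (Fin 3) ℂ)ᴴ), ← Matrix.mul_assoc (((k : GL (Fin 3) ℂ) : Matrix (Fin 3) (Fin 3) ℂ)ᴴ)] at *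
    rw [e, hJ]
  rw [Subgroup.coe_inv, Matrix.coe_units_inv]
  exact (Matrix.inv_eq_left_inv hleft).symm

end Ambient

/-! ## §2 `Θ^∨ = Θ ∘ (A ↦ J⁻¹AᴴJ)`: smooth, compactly supported on the group, orbital integral `Φ_{Θ^∨}(z) = Φ_Θ(z⁻¹)` -/

section ThetaVee

variable (L : Type) [Field L] (α : Fin 3 → L) (w : {w : InfinitePlace L // IsComplex w})

/-- `Θ^∨` is smooth when `Θ` is. [cite: PlatonovRapinchuk1994, §2.3] -/
theorem contDiff_comp_adj (Θ : Matrix (Fin 3) (Fin 3) ℂ → ℂ) (hΘ : ContDiff ℝ (⊤ : ℕ∞) Θ) :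
    ContDiff ℝ (⊤ : ℕ∞) (fun A : Matrix (Fin 3) (Fin 3) ℂ => Θ (Matrix.diagonal (fun i : Fin 3 => (w.1.embedding (α i))⁻¹) * Aᴴ * Matrix.diagonal (fun i : Fin 3 => w.1.embedding (α i)))) :=
  hΘ.comp ((contDiff_const.mul contDiff_conjTranspose_fin_three).mul contDiff_const)

/-- On the group `Θ^∨(k) = Θ(k⁻¹)`. [cite: PlatonovRapinchuk1994, §2.3] -/
theorem comp_adj_apply_coe (hα : ∀ i, α i ≠ 0) (Θ : Matrix (Fin 3) (Fin 3) ℂ → ℂ) (k : archLocal L 3 (Matrix.diagonal α) w) :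
    Θ (Matrix.diagonal (fun i : Fin 3 => (w.1.embedding (α i))⁻¹) * ((k : GL (Fin 3) ℂ) : Matrix (Fin 3) (Fin 3) ℂ)ᴴ * Matrix.diagonal (fun i : Fin 3 => w.1.embedding (α i))) = Θ (((k⁻¹ : archLocal L 3 (Matrix.diagonal α) w) : GL (Fin 3) ℂ) : Matrix (Fin 3) (Fin 3) ℂ) := by
  rw [diagonal_inv_mul_conjTranspose_mul_diagonal_eq_inv L α w hα k]

/-- `Θ^∨` has compact support on the group when `Θ` has (inversion is a homeomorphism of `G_w`). [cite: PlatonovRapinchuk1994, §2.3] -/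
theorem hasCompactSupport_comp_adj (hα : ∀ i, α i ≠ 0) (Θ : Matrix (Fin 3) (Fin 3) ℂ → ℂ)
    (hΘc : HasCompactSupport (fun k : archLocal L 3 (Matrix.diagonal α) w => Θ ((k : GL (Fin 3) ℂ) : Matrix (Fin 3) (Fin 3) ℂ))) :
    HasCompactSupport (fun k : archLocal L 3 (Matrix.diagonal α) w => Θ (Matrix.diagonal (fun i : Fin 3 => (w.1.embedding (α i))⁻¹) * ((k : GL (Fin 3) ℂ) : Matrix (Fin 3) (Fin 3) ℂ)ᴴ * Matrix.diagonal (fun i : Fin 3 => w.1.embedding (α i)))) := by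
  have heq : (fun k : archLocal L 3 (Matrix.diagonal α) w => Θ (Matrix.diagonal (fun i : Fin 3 => (w.1.embedding (α i))⁻¹) * ((k : GL (Fin 3) ℂ) : Matrix (Fin 3) (Fin 3) ℂ)ᴴ * Matrix.diagonal (fun i : Fin 3 => w.1.embedding (α i)))) =
      (fun k : archLocal L 3 (Matrix.diagonal α) w => Θ ((k : GL (Fin 3) ℂ) : Matrix (Fin 3) (Fin 3) ℂ)) ∘ (Homeomorph.inv (archLocal L 3 (Matrix.diagonal α) w)) := by
    funext k
    simp only [Function.comp_apply, Homeomorph.coe_inv]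
    exact comp_adj_apply_coe L α w hα Θ k
  rw [heq]
  exact hΘc.comp_homeomorph _

/-- The torus point of the reflected chart is the inverse: `t(ζ⁻¹e^{iθ}) = t(ζe^{−iθ})⁻¹` in `G_w`. [cite: Rogawski1990, §8.4 p. 126] -/
theorem torus_angleChart_inv_eq (ζ : Circle) (θ : Fin 3 → ℝ) :
    (⟨circleDiagonal 3 (fun k => ζ⁻¹ * Circle.exp (θ k)), circleDiagonal_mem_archLocal_diagonal L 3 α w _⟩ : archLocal L 3 (Matrix.diagonal α) w) =
      (⟨circleDiagonal 3 (fun k => ζ * Circle.exp ((-θ) k)), circleDiagonal_mem_archLocal_diagonal L 3 α w _⟩ : archLocal L 3 (Matrix.diagonal α) w)⁻¹ := by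
  apply Subtype.ext
  show circleDiagonal 3 (fun k => ζ⁻¹ * Circle.exp (θ k)) =
    (((⟨circleDiagonal 3 (fun k => ζ * Circle.exp ((-θ) k)), circleDiagonal_mem_archLocal_diagonal L 3 α w _⟩ : archLocal L 3 (Matrix.diagonal α) w)⁻¹ :
      archLocal L 3 (Matrix.diagonal α) w) : GL (Fin 3) ℂ)
  rw [Subgroup.coe_inv]
  show circleDiagonal 3 (fun k => ζ⁻¹ * Circle.exp (θ k)) = (circleDiagonal 3 (fun k => ζ * Circle.exp ((-θ) k)))⁻¹
  rw [← map_inv]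
  congr 1
  funext k
  rw [Pi.inv_apply, Pi.neg_apply, Circle.exp_neg, mul_inv, inv_inv]

/-- **`Φ_{Θ^∨}(ζ⁻¹e^{iθ}) = Φ_Θ(ζe^{−iθ})`** — the orbital integral of `Θ^∨` at a torus point is that of `Θ` at the inverse point, for the SAME measure (`(g·t·g⁻¹)⁻¹ = g·t⁻¹·g⁻¹`).
[cite: Rogawski1990, §8.4 p. 126] -/
theorem integral_comp_adj_conj_angleChart (hα : ∀ i, α i ≠ 0) [MeasurableSpace (archLocal L 3 (Matrix.diagonal α) w)]
    (ν : Measure (archLocal L 3 (Matrix.diagonal α) w)) (Θ : Matrix (Fin 3) (Fin 3) ℂ → ℂ) (ζ : Circle) (θ : Fin 3 → ℝ) :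
    (∫ g, Θ (Matrix.diagonal (fun i : Fin 3 => (w.1.embedding (α i))⁻¹) * (((g * ⟨circleDiagonal 3 (fun k => ζ⁻¹ * Circle.exp (θ k)), circleDiagonal_mem_archLocal_diagonal L 3 α w _⟩ * g⁻¹ : archLocal L 3 (Matrix.diagonal α) w) : GL (Fin 3) ℂ) : Matrix (Fin 3) (Fin 3) ℂ)ᴴ * Matrix.diagonal (fun i : Fin 3 => w.1.embedding (α i))) ∂ν) =
      (∫ g, Θ (((g * ⟨circleDiagonal 3 (fun k => ζ * Circle.exp ((-θ) k)), circleDiagonal_mem_archLocal_diagonal L 3 α w _⟩ * g⁻¹ : archLocal L 3 (Matrix.diagonal α) w) : GL (Fin 3) ℂ) : Matrix (Fin 3) (Fin 3) ℂ) ∂ν) := by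
  refine integral_congr_ae (Filter.Eventually.of_forall fun g => ?_)
  dsimp only
  rw [comp_adj_apply_coe L α w hα Θ, torus_angleChart_inv_eq L α w ζ θ]
  simp only [_root_.mul_inv_rev, inv_inv, mul_assoc]

end ThetaVee

/-! ## §3 The reflected Weyl factor and the reflected letter density: `F_{Θ^∨}(ζ⁻¹e^{iθ}) = −F_Θ(ζe^{−iθ})` -/

section Density

variable (L : Type) [Field L] (α : Fin 3 → L) (w : {w : InfinitePlace L // IsComplex w})

/-- `ρ′Δ(u⁻¹) = −ρ′Δ(u)` for unit complex numbers (here: the chart points `ζ⁻¹e^{iθ_k} = (ζe^{−iθ_k})⁻¹`). [cite: Rogawski1990, §8.4 p. 126] -/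
theorem rhoWeylDelta_angleChart_inv (ζ : Circle) (θ : Fin 3 → ℝ) :
    ((((ζ⁻¹ * Circle.exp (θ 0) : Circle) : ℂ)) * (((ζ⁻¹ * Circle.exp (θ 2) : Circle) : ℂ))⁻¹) * ((1 - (((ζ⁻¹ * Circle.exp (θ 1) : Circle) : ℂ)) * (((ζ⁻¹ * Circle.exp (θ 0) : Circle) : ℂ))⁻¹) * (1 - (((ζ⁻¹ * Circle.exp (θ 2) : Circle) : ℂ)) * (((ζ⁻¹ * Circle.exp (θ 1) : Circle) : ℂ))⁻¹) * (1 - (((ζ⁻¹ * Circle.exp (θ 2) : Circle) : ℂ)) * (((ζ⁻¹ * Circle.exp (θ 0) : Circle) : ℂ))⁻¹)) =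
      -(((((ζ * Circle.exp ((-θ) 0) : Circle) : ℂ)) * (((ζ * Circle.exp ((-θ) 2) : Circle) : ℂ))⁻¹) * ((1 - (((ζ * Circle.exp ((-θ) 1) : Circle) : ℂ)) * (((ζ * Circle.exp ((-θ) 0) : Circle) : ℂ))⁻¹) * (1 - (((ζ * Circle.exp ((-θ) 2) : Circle) : ℂ)) * (((ζ * Circle.exp ((-θ) 1) : Circle) : ℂ))⁻¹) * (1 - (((ζ * Circle.exp ((-θ) 2) : Circle) : ℂ)) * (((ζ * Circle.exp ((-θ) 0) : Circle) : ℂ))⁻¹))) := by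
  have hk : ∀ k : Fin 3, (((ζ⁻¹ * Circle.exp (θ k) : Circle) : ℂ)) = ((((ζ * Circle.exp ((-θ) k) : Circle) : ℂ)))⁻¹ := by
    intro k
    rw [← Circle.coe_inv, Pi.neg_apply, Circle.exp_neg, mul_inv, inv_inv]
  rw [hk 0, hk 1, hk 2]
  have h0 : (((ζ * Circle.exp ((-θ) 0) : Circle) : ℂ)) ≠ 0 := Circle.coe_ne_zero _
  have h1 : (((ζ * Circle.exp ((-θ) 1) : Circle) : ℂ)) ≠ 0 := Circle.coe_ne_zero _
  have h2 : (((ζ * Circle.exp ((-θ) 2) : Circle) : ℂ)) ≠ 0 := Circle.coe_ne_zero _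
  field_simp
  ring

/-- **`F_{Θ^∨}(ζ⁻¹e^{iθ}) = −F_Θ(ζe^{−iθ})`** in the letter's tokens. [cite: Rogawski1990, §8.4 p. 126] -/
theorem letterDensity_comp_adj_angleChart (hα : ∀ i, α i ≠ 0) [MeasurableSpace (archLocal L 3 (Matrix.diagonal α) w)]
    (ν : Measure (archLocal L 3 (Matrix.diagonal α) w)) (Θ : Matrix (Fin 3) (Fin 3) ℂ → ℂ) (ζ : Circle) (θ : Fin 3 → ℝ) :
    ((((ζ⁻¹ * Circle.exp (θ 0) : Circle) : ℂ)) * (((ζ⁻¹ * Circle.exp (θ 2) : Circle) : ℂ))⁻¹) * ((1 - (((ζ⁻¹ * Circle.exp (θ 1) : Circle) : ℂ)) * (((ζ⁻¹ * Circle.exp (θ 0) : Circle) : ℂ))⁻¹) * (1 - (((ζ⁻¹ * Circle.exp (θ 2) : Circle) : ℂ)) * (((ζ⁻¹ * Circle.exp (θ 1) : Circle) : ℂ))⁻¹) * (1 - (((ζ⁻¹ * Circle.exp (θ 2) : Circle) : ℂ)) * (((ζ⁻¹ * Circle.exp (θ 0) : Circle) : ℂ))⁻¹)) * (∫ g, Θ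 (Matrix.diagonal (fun i : Fin 3 => (w.1.embedding (α i))⁻¹) * (((g * ⟨circleDiagonal 3 (fun k => ζ⁻¹ * Circle.exp (θ k)), circleDiagonal_mem_archLocal_diagonal L 3 α w _⟩ * g⁻¹ : archLocal L 3 (Matrix.diagonal α) w) : GL (Fin 3) ℂ) : Matrix (Fin 3) (Fin 3) ℂ)ᴴ * Matrix.diagonal (fun i : Fin 3 => w.1.embedding (α i))) ∂ν) =
      -(((((ζ * Circle.exp ((-θ) 0) : Circle) : ℂ)) * (((ζ * Circle.exp ((-θ) 2) : Circle) : ℂ))⁻¹) * ((1 - (((ζ * Circle.exp ((-θ) 1) : Circle) : ℂ)) * (((ζ * Circle.exp ((-θ) 0) : Circle) : ℂ))⁻¹) * (1 - (((ζ * Circle.exp ((-θ) 2) : Circle) : ℂ)) * (((ζ * Circle.exp ((-θ) 1) : Circle) : ℂ))⁻¹) * (1 - (((ζ * Circle.exp ((-θ) 2) : Circle) : ℂ)) * (((ζ * Circle.exp ((-θ) 0) : Circle) : ℂ))⁻¹)) * (∫ g, Θ (((g * ⟨circleDiagonal 3 (fun k => ζ * Circle.exp ((-θ) k)), circleDiagonal_mem_archLocal_diagonal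 L 3 α w _⟩ * g⁻¹ : archLocal L 3 (Matrix.diagonal α) w) : GL (Fin 3) ℂ) : Matrix (Fin 3) (Fin 3) ℂ) ∂ν)) := by
  rw [integral_comp_adj_conj_angleChart L α w hα ν Θ ζ θ, rhoWeylDelta_angleChart_inv ζ θ, neg_mul]

end Density

/-! ## §4 The 8-ray corner functional is invariant under `H ↦ −H(−·)` -/

section Functional

/-- `(d∕ds)³|₀ [−H(−s·v)] = (d∕ds)³|₀ [H(s·v)]` (two sign flips from `H ↦ −H` and `(−1)³`, one from nothing: they cancel). [cite: Rogawski1990, §8.4 p. 126] -/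
theorem iteratedDeriv_three_neg_comp_neg (H : (Fin 3 → ℝ) → ℂ) (v : Fin 3 → ℝ) :
    iteratedDeriv 3 (fun s : ℝ => -H (-(s • v))) 0 = iteratedDeriv 3 (fun s : ℝ => H (s • v)) 0 := by
  have h1 : (fun s : ℝ => -H (-(s • v))) = fun s : ℝ => -((fun r : ℝ => H (r • v)) (-s)) := by
    funext s
    simp only [neg_smul]
  rw [h1, iteratedDeriv_fun_neg, iteratedDeriv_comp_neg 3 (fun r : ℝ => H (r • v)) 0]
  norm_num

end Functional

/-! ## §5 The D-chamber value on the `θ₂`-maximal pair from the `θ₂`-minimal pair -/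

section MaxOfMin

variable {L : Type} [Field L] {α : Fin 3 → L} {w : {w : InfinitePlace L // IsComplex w}}

/-- **THE CORNER VALUE ON `σ 2 = 2` FROM `σ 0 = 2`** (inversion symmetry): if for every Haar right-invariant `ν` there is `c > 0` with `Λ₈^∠[H](0) = −(c·i)·Θ(ζ•1)` for every ambient test
function `Θ`, every `ζ` and every `C³` corner extension `H` of `F_Θ∘chart_ζ` on a `θ₂`-MINIMAL chamber (`σ 0 = 2`), then the same holds on the `θ₂`-MAXIMAL chambers too (`σ 2 = 2`) — apply
the hypothesis to `Θ^∨`, `ζ⁻¹`, `σ·(0 2)` and `H^∨(θ) = −H(−θ)`. [cite: Rogawski1990, §8.4 pp. 126–127] [cite: HarishChandra1975HARRG1, §17 Lemma 17.5] -/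
theorem cornerValue_max_of_min
    (hDmin : ∀ [MeasurableSpace (archLocal L 3 (Matrix.diagonal α) w)] [BorelSpace (archLocal L 3 (Matrix.diagonal α) w)],
      (∀ i, α i ≠ 0) → (∀ i, (w.1.embedding (α i)).im = 0) →
      (∃ i j : Fin 3, (w.1.embedding (α i)).re * (w.1.embedding (α j)).re < 0) →
      ∀ (ν : Measure (archLocal L 3 (Matrix.diagonal α) w)) [ν.IsHaarMeasure] [ν.IsMulRightInvariant],
      ∃ c : ℝ, 0 < c ∧
        ∀ (Θ : Matrix (Fin 3) (Fin 3) ℂ → ℂ), ContDiff ℝ (⊤ : ℕ∞) Θ →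
          HasCompactSupport (fun k : archLocal L 3 (Matrix.diagonal α) w => Θ ((k : GL (Fin 3) ℂ) : Matrix (Fin 3) (Fin 3) ℂ)) →
          ∀ (ζ : Circle) (σ : Equiv.Perm (Fin 3)), (σ 0 = 2) →
            ∀ (U : Set (Fin 3 → ℝ)) (H : (Fin 3 → ℝ) → ℂ), IsOpen U → (0 : Fin 3 → ℝ) ∈ U → ContDiffOn ℝ 3 H U →
            (∀ θ ∈ U, θ (σ 0) < θ (σ 1) ∧ θ (σ 1) < θ (σ 2) →
              H θ = ((((ζ * Circle.exp (θ 0) : Circle) : ℂ)) * (((ζ * Circle.exp (θ 2) : Circle) : ℂ))⁻¹) * ((1 - (((ζ * Circle.exp (θ 1) : Circle) : ℂ)) * (((ζ * Circle.exp (θ 0) : Circle) : ℂ))⁻¹) * (1 - (((ζ * Circle.exp (θ 2) : Circle) : ℂ)) * (((ζ * Circle.exp (θ 1) : Circle) : ℂ))⁻¹) * (1 - (((ζ * Circle.exp (θ 2) : Circle) : ℂ)) * (((ζ * Circle.exp (θ 0) : Circle) : ℂ))⁻¹)) * (∫ g, Θ (((g * ⟨circleDiagonal 3 (fun k => ζ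 * Circle.exp (θ k)), circleDiagonal_mem_archLocal_diagonal L 3 α w _⟩ * g⁻¹ : archLocal L 3 (Matrix.diagonal α) w) : GL (Fin 3) ℂ) : Matrix (Fin 3) (Fin 3) ℂ) ∂ν)) →
            (1 / 48 : ℂ) * ∑ ε : Fin 3 → Bool, ((((if ε 0 then (1 : ℝ) else -1) * (if ε 1 then (1 : ℝ) else -1) * (if ε 2 then (1 : ℝ) else -1) : ℝ)) : ℂ) *
          iteratedDeriv 3 (fun s : ℝ => H (s • ![(if ε 0 then (1 : ℝ) else -1) + (if ε 1 then (1 : ℝ) else -1), -(if ε 0 then (1 : ℝ) else -1) + (if ε 2 then (1 : ℝ) else -1), -(if ε 1 then (1 : ℝ) else -1) - (if ε 2 then (1 : ℝ) else -1)])) 0 =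
                -((c : ℂ) * Complex.I) * Θ ((circleDiagonal 3 (fun _ => ζ) : GL (Fin 3) ℂ) : Matrix (Fin 3) (Fin 3) ℂ)) :
    ∀ [MeasurableSpace (archLocal L 3 (Matrix.diagonal α) w)] [BorelSpace (archLocal L 3 (Matrix.diagonal α) w)],
      (∀ i, α i ≠ 0) → (∀ i, (w.1.embedding (α i)).im = 0) →
      (∃ i j : Fin 3, (w.1.embedding (α i)).re * (w.1.embedding (α j)).re < 0) →
      ∀ (ν : Measure (archLocal L 3 (Matrix.diagonal α) w)) [ν.IsHaarMeasure] [ν.IsMulRightInvariant],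
      ∃ c : ℝ, 0 < c ∧
        ∀ (Θ : Matrix (Fin 3) (Fin 3) ℂ → ℂ), ContDiff ℝ (⊤ : ℕ∞) Θ →
          HasCompactSupport (fun k : archLocal L 3 (Matrix.diagonal α) w => Θ ((k : GL (Fin 3) ℂ) : Matrix (Fin 3) (Fin 3) ℂ)) →
          ∀ (ζ : Circle) (σ : Equiv.Perm (Fin 3)), (σ 0 = 2 ∨ σ 2 = 2) →
            ∀ (U : Set (Fin 3 → ℝ)) (H : (Fin 3 → ℝ) → ℂ), IsOpen U → (0 : Fin 3 → ℝ) ∈ U → ContDiffOn ℝ 3 H U →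
            (∀ θ ∈ U, θ (σ 0) < θ (σ 1) ∧ θ (σ 1) < θ (σ 2) →
              H θ = ((((ζ * Circle.exp (θ 0) : Circle) : ℂ)) * (((ζ * Circle.exp (θ 2) : Circle) : ℂ))⁻¹) * ((1 - (((ζ * Circle.exp (θ 1) : Circle) : ℂ)) * (((ζ * Circle.exp (θ 0) : Circle) : ℂ))⁻¹) * (1 - (((ζ * Circle.exp (θ 2) : Circle) : ℂ)) * (((ζ * Circle.exp (θ 1) : Circle) : ℂ))⁻¹) * (1 - (((ζ * Circle.exp (θ 2) : Circle) : ℂ)) * (((ζ * Circle.exp (θ 0) : Circle) : ℂ))⁻¹)) * (∫ g, Θ (((g * ⟨circleDiagonal 3 (fun k => ζ * Circle.exp (θ k)), circleDiagonal_mem_archLocal_diagonal L 3 α w _⟩ * g⁻¹ : archLocal L 3 (Matrix.diagonal α) w) : GL (Fin 3) ℂ) : Matrix (Fin 3) (Fin 3) ℂ) ∂ν)) →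
            (1 / 48 : ℂ) * ∑ ε : Fin 3 → Bool, ((((if ε 0 then (1 : ℝ) else -1) * (if ε 1 then (1 : ℝ) else -1) * (if ε 2 then (1 : ℝ) else -1) : ℝ)) : ℂ) *
          iteratedDeriv 3 (fun s : ℝ => H (s • ![(if ε 0 then (1 : ℝ) else -1) + (if ε 1 then (1 : ℝ) else -1), -(if ε 0 then (1 : ℝ) else -1) + (if ε 2 then (1 : ℝ) else -1), -(if ε 1 then (1 : ℝ) else -1) - (if ε 2 then (1 : ℝ) else -1)])) 0 =
                -((c : ℂ) * Complex.I) * Θ ((circleDiagonal 3 (fun _ => ζ) : GL (Fin 3) ℂ) : Matrix (Fin 3) (Fin 3) ℂ) := by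
  intro _ _ hα hreal hind ν _ _
  obtain ⟨c, hc, hmin⟩ := hDmin hα hreal hind ν
  refine ⟨c, hc, fun Θ hΘ hΘc ζ σ hσ U H hUo h0U hH hHF => ?_⟩
  rcases hσ with hσ | hσ
  · exact hmin Θ hΘ hΘc ζ σ hσ U H hUo h0U hH hHF
  -- `σ 2 = 2`: reflect through the inversion symmetry
  have hσ' : (σ * Equiv.swap (0 : Fin 3) 2) 0 = 2 := by
    rw [Equiv.Perm.mul_apply, Equiv.swap_apply_left, hσ]
  have hσ'1 : (σ * Equiv.swap (0 : Fin 3) 2) 1 = σ 1 := by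
    rw [Equiv.Perm.mul_apply, Equiv.swap_apply_of_ne_of_ne (by decide) (by decide)]
  have hσ'2 : (σ * Equiv.swap (0 : Fin 3) 2) 2 = σ 0 := by
    rw [Equiv.Perm.mul_apply, Equiv.swap_apply_right]
  have hU'o : IsOpen {θ : Fin 3 → ℝ | -θ ∈ U} := hUo.preimage continuous_neg
  have h0U' : (0 : Fin 3 → ℝ) ∈ {θ : Fin 3 → ℝ | -θ ∈ U} := by simpa only [mem_setOf_eq, neg_zero] using h0U
  have hH' : ContDiffOn ℝ 3 (fun θ : Fin 3 → ℝ => -H (-θ)) {θ : Fin 3 → ℝ | -θ ∈ U} :=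
    (hH.comp contDiff_neg.contDiffOn (fun θ hθ => hθ)).neg
  -- the reflected extension agrees with `F_{Θ^∨}∘chart_{ζ⁻¹}` on the reflected chamber
  have hHF' : ∀ θ ∈ {θ : Fin 3 → ℝ | -θ ∈ U}, θ ((σ * Equiv.swap (0 : Fin 3) 2) 0) < θ ((σ * Equiv.swap (0 : Fin 3) 2) 1) ∧
      θ ((σ * Equiv.swap (0 : Fin 3) 2) 1) < θ ((σ * Equiv.swap (0 : Fin 3) 2) 2) →
      (fun θ : Fin 3 → ℝ => -H (-θ)) θ = ((((ζ⁻¹ * Circle.exp (θ 0) : Circle) : ℂ)) * (((ζ⁻¹ * Circle.exp (θ 2) : Circle) : ℂ))⁻¹) * ((1 - (((ζ⁻¹ * Circle.exp (θ 1) : Circle) : ℂ)) * (((ζ⁻¹ * Circle.exp (θ 0) : Circle) : ℂ))⁻¹) * (1 - (((ζ⁻¹ * Circle.exp (θ 2) : Circle) : ℂ)) * (((ζ⁻¹ * Circle.exp (θ 1) : Circle) : ℂ))⁻¹) * (1 - (((ζ⁻¹ * Circle.exp (θ 2) : Circle) : ℂ)) * (((ζ⁻¹ * Circle.exp (θ 0)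 : Circle) : ℂ))⁻¹)) * (∫ g, Θ (Matrix.diagonal (fun i : Fin 3 => (w.1.embedding (α i))⁻¹) * (((g * ⟨circleDiagonal 3 (fun k => ζ⁻¹ * Circle.exp (θ k)), circleDiagonal_mem_archLocal_diagonal L 3 α w _⟩ * g⁻¹ : archLocal L 3 (Matrix.diagonal α) w) : GL (Fin 3) ℂ) : Matrix (Fin 3) (Fin 3) ℂ)ᴴ * Matrix.diagonal (fun i : Fin 3 => w.1.embedding (α i))) ∂ν) := by
    intro θ hθ hch
    rw [hσ', hσ'1, hσ'2] at hch
    have hch' : (-θ) (σ 0) < (-θ) (σ 1) ∧ (-θ) (σ 1) < (-θ) (σ 2) := by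
      rw [hσ]
      simp only [Pi.neg_apply]
      exact ⟨neg_lt_neg hch.2, neg_lt_neg hch.1⟩
    have e := hHF (-θ) hθ hch'
    dsimp only
    rw [e, letterDensity_comp_adj_angleChart L α w hα ν Θ ζ θ]
  have key := hmin (fun A : Matrix (Fin 3) (Fin 3) ℂ => Θ (Matrix.diagonal (fun i : Fin 3 => (w.1.embedding (α i))⁻¹) * Aᴴ * Matrix.diagonal (fun i : Fin 3 => w.1.embedding (α i)))) (contDiff_comp_adj L α w Θ hΘ)
    (hasCompactSupport_comp_adj L α w hα Θ hΘc) ζ⁻¹ (σ * Equiv.swap (0 : Fin 3) 2) hσ' {θ : Fin 3 → ℝ | -θ ∈ U} (fun θ : Fin 3 → ℝ => -H (-θ)) hU'o h0U' hH' hHF'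
  beta_reduce at key
  -- the centre value `Θ^∨(ζ⁻¹•1) = Θ(ζ•1)`
  have hcen : Θ (Matrix.diagonal (fun i : Fin 3 => (w.1.embedding (α i))⁻¹) * ((circleDiagonal 3 (fun _ : Fin 3 => ζ⁻¹) : GL (Fin 3) ℂ) : Matrix (Fin 3) (Fin 3) ℂ)ᴴ * Matrix.diagonal (fun i : Fin 3 => w.1.embedding (α i))) =
      Θ ((circleDiagonal 3 (fun _ : Fin 3 => ζ) : GL (Fin 3) ℂ) : Matrix (Fin 3) (Fin 3) ℂ) := by
    have h := comp_adj_apply_coe L α w hα Θ (⟨circleDiagonal 3 (fun _ : Fin 3 => ζ⁻¹), circleDiagonal_mem_archLocal_diagonal L 3 α w _⟩ : archLocal L 3 (Matrix.diagonal α) w)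
    rw [Subgroup.coe_inv, ← map_inv] at h
    have hz : (fun _ : Fin 3 => ζ⁻¹)⁻¹ = fun _ : Fin 3 => ζ := by
      funext k
      rw [Pi.inv_apply, inv_inv]
    rw [hz] at h
    exact h
  simp only [iteratedDeriv_three_neg_comp_neg, hcen] at key
  exact key

/-- **N1 FROM {(A6), THE D-CHAMBER WALL VALUE ON THE `θ₂`-MINIMAL PAIR ONLY, THE (J3-odd)₃ CUBE LIMITS}** — ★ FILE B with `hD` restricted to `σ 0 = 2` (wall parameters `t > 0`, where the
(A3) germs ★ `exists_wallGerm_psi` live); the `θ₂`-maximal pair comes from `cornerValue_max_of_min`. [cite: Rogawski1990, §8.4 pp. 126–127] [cite: HarishChandra1975HARRG1, §17 Lemma 17.5] -/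
theorem ArchCentralLimitFormulaRankTwo.of_cornerRegularity_of_wallValues_min [NumberField L] [IsCMField L]
    (h02 : (w.1.embedding (α 0)).re * (w.1.embedding (α 2)).re < 0)
    (hreg : ArchCentralLimitCornerRegularity L α w)
    (hDmin : ∀ [MeasurableSpace (archLocal L 3 (Matrix.diagonal α) w)] [BorelSpace (archLocal L 3 (Matrix.diagonal α) w)],
      (∀ i, α i ≠ 0) → (∀ i, (w.1.embedding (α i)).im = 0) →
      (∃ i j : Fin 3, (w.1.embedding (α i)).re * (w.1.embedding (α j)).re < 0) →
      ∀ (ν : Measure (archLocal L 3 (Matrix.diagonal α) w)) [ν.IsHaarMeasure] [ν.IsMulRightInvariant],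
      ∃ c : ℝ, 0 < c ∧
        ∀ (Θ : Matrix (Fin 3) (Fin 3) ℂ → ℂ), ContDiff ℝ (⊤ : ℕ∞) Θ →
          HasCompactSupport (fun k : archLocal L 3 (Matrix.diagonal α) w => Θ ((k : GL (Fin 3) ℂ) : Matrix (Fin 3) (Fin 3) ℂ)) →
          ∀ (ζ : Circle) (σ : Equiv.Perm (Fin 3)), (σ 0 = 2) →
            ∀ (U : Set (Fin 3 → ℝ)) (H : (Fin 3 → ℝ) → ℂ), IsOpen U → (0 : Fin 3 → ℝ) ∈ U → ContDiffOn ℝ 3 H U →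
            (∀ θ ∈ U, θ (σ 0) < θ (σ 1) ∧ θ (σ 1) < θ (σ 2) →
              H θ = ((((ζ * Circle.exp (θ 0) : Circle) : ℂ)) * (((ζ * Circle.exp (θ 2) : Circle) : ℂ))⁻¹) * ((1 - (((ζ * Circle.exp (θ 1) : Circle) : ℂ)) * (((ζ * Circle.exp (θ 0) : Circle) : ℂ))⁻¹) * (1 - (((ζ * Circle.exp (θ 2) : Circle) : ℂ)) * (((ζ * Circle.exp (θ 1) : Circle) : ℂ))⁻¹) * (1 - (((ζ * Circle.exp (θ 2) : Circle) : ℂ)) * (((ζ * Circle.exp (θ 0) : Circle) : ℂ))⁻¹)) * (∫ g, Θ (((g * ⟨circleDiagonal 3 (fun k => ζ * Circle.exp (θ k)), circleDiagonal_mem_archLocal_diagonal L 3 α w _⟩ * g⁻¹ : archLocal L 3 (Matrix.diagonal α) w) : GL (Fin 3) ℂ) : Matrix (Fin 3) (Fin 3) ℂ) ∂ν)) →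
            (1 / 48 : ℂ) * ∑ ε : Fin 3 → Bool, ((((if ε 0 then (1 : ℝ) else -1) * (if ε 1 then (1 : ℝ) else -1) * (if ε 2 then (1 : ℝ) else -1) : ℝ)) : ℂ) *
          iteratedDeriv 3 (fun s : ℝ => H (s • ![(if ε 0 then (1 : ℝ) else -1) + (if ε 1 then (1 : ℝ) else -1), -(if ε 0 then (1 : ℝ) else -1) + (if ε 2 then (1 : ℝ) else -1), -(if ε 1 then (1 : ℝ) else -1) - (if ε 2 then (1 : ℝ) else -1)])) 0 =
                -((c : ℂ) * Complex.I) * Θ ((circleDiagonal 3 (fun _ => ζ) : GL (Fin 3) ℂ) : Matrix (Fin 3) (Fin 3) ℂ))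
    (hS : ∀ [MeasurableSpace (archLocal L 3 (Matrix.diagonal α) w)] [BorelSpace (archLocal L 3 (Matrix.diagonal α) w)],
      (∀ i, α i ≠ 0) → (∀ i, (w.1.embedding (α i)).im = 0) →
      ∀ (ν : Measure (archLocal L 3 (Matrix.diagonal α) w)) [ν.IsHaarMeasure] [ν.IsMulRightInvariant]
        (Θ : Matrix (Fin 3) (Fin 3) ℂ → ℂ), ContDiff ℝ (⊤ : ℕ∞) Θ →
          HasCompactSupport (fun k : archLocal L 3 (Matrix.diagonal α) w => Θ ((k : GL (Fin 3) ℂ) : Matrix (Fin 3) (Fin 3) ℂ)) →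
          ∀ (ζ : Circle) (t : ℝ), Real.cos (3 * t) ≠ 1 →
            ∃ Lim : ℂ, Tendsto (fun ψ : ℝ => iteratedDeriv 3 (fun s : ℝ =>
              ((((ζ * Circle.exp ((t • (![1, -2, 1] : Fin 3 → ℝ) + s • (![1, 0, -1] : Fin 3 → ℝ)) 0) : Circle) : ℂ)) * (((ζ * Circle.exp ((t • (![1, -2, 1] : Fin 3 → ℝ) + s • (![1, 0, -1] : Fin 3 → ℝ)) 2) : Circle) : ℂ))⁻¹) * ((1 - (((ζ * Circle.exp ((t • (![1, -2, 1] : Fin 3 → ℝ) + s • (![1, 0, -1] : Fin 3 → ℝ)) 1) : Circle) : ℂ)) * (((ζ * Circle.exp ((t • (![1, -2, 1] : Fin 3 → ℝ) + s • (![1, 0, -1] : Fin 3 → ℝ)) 0) : Circle) : ℂ))⁻¹) * (1 - (((ζ * Circle.exp ((t • (![1, -2, 1] : Fin 3 → ℝ) + s • (![1, 0, -1] : Fin 3 → ℝ)) 2) : Circle) : ℂ)) * (((ζ * Circle.exp ((t • (![1, -2, 1] : Fin 3 → ℝ) + s • (![1, 0, -1] : Fin 3 → ℝ)) 1) : Circle)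 : ℂ))⁻¹) * (1 - (((ζ * Circle.exp ((t • (![1, -2, 1] : Fin 3 → ℝ) + s • (![1, 0, -1] : Fin 3 → ℝ)) 2) : Circle) : ℂ)) * (((ζ * Circle.exp ((t • (![1, -2, 1] : Fin 3 → ℝ) + s • (![1, 0, -1] : Fin 3 → ℝ)) 0) : Circle) : ℂ))⁻¹)) * (∫ g, Θ (((g * ⟨circleDiagonal 3 (fun k => ζ * Circle.exp ((t • (![1, -2, 1] : Fin 3 → ℝ) + s • (![1, 0, -1] : Fin 3 → ℝ)) k)), circleDiagonal_mem_archLocal_diagonal L 3 α w _⟩ * g⁻¹ : archLocal L 3 (Matrix.diagonal α) w) : GL (Fin 3) ℂ) : Matrix (Fin 3) (Fin 3) ℂ) ∂ν)) ψ) (𝓝[≠] 0) (𝓝 Lim)) :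
    ArchCentralLimitFormulaRankTwo L α w :=
  ArchCentralLimitFormulaRankTwo.of_cornerRegularity_of_wallValues h02 hreg (cornerValue_max_of_min hDmin) hS

end MaxOfMin

end Literature.NumberTheory.Rogawski1990

end
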